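import Summits.QuantumFields.YangMills.Theorems.UnitScaleTiltProp7TPrintDefs
import Literature.MathematicalPhysics.QuantumFieldTheory.Balaban1983to89.B10Eq18SigmaSU2Haar
import Literature.MathematicalPhysics.QuantumFieldTheory.Balaban1983to89.T4ExpWindowSmallField
import Literature.MathematicalPhysics.QuantumLattice.Z2GaugeHiggsTorus
import HarnessLib

/-!
# NEG-hPcol piece (N2a): the one-axis Pauli exponential `t ↦ exp(i t σ_μ)` in closed form — Euler's formula, the
# one-parameter group law, the distance to `1`, and the dictionary to the route's `expHerm` and to print's chart `expPauli`

Cell `ym3-torus` (YM ladder rung R3 = continuum SU(2) Yang–Mills on T³ — a RUNG, NOT d = 4, NOT infinite volume, NOT a mass gap,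
NOT the Clay problem), width seat `ym3-torus-px6` (gen 11), crux of record `MinimiserStabilityRegPr` (stmt-QuantumFields-19200,
route `UnitScaleTilt`).  ★★OWNER WORD 38 (2026-08-29T18:26Z) «NEG-hPcol — GO»: a kernel certificate that the S42ᴸ display row
`hPcol` (pre-`Lift` text, ✓p729698) is NOT inhabitable, on px12 g11's explicit stratum-(c) family
`U_s(b) := expHerm ((s·θ(b)) • σ_{dir b})` (LOCATE v2.1 8aced68d).  px12 g11's NAMING LINE (18:30:32Z) cut the certificate into six
pieces (module names carry the token `Neg`, ★★OWNER WORD 38 AMENDMENT 18:37Z); THIS FILE is piece **(N2a)**: the elementary `2 × 2` calculus of the bond values `exp(i t σ_μ)` that the lattice pieces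
(N3)–(N6) and the sibling letters (N2b) «group commutator of two axes» (px9 g10) ∕ (N2c) «commutant of two axes» (px15 g8) cite.

WHAT IS PROVED (def-free; `σ_μ := spinHalfPauli μ`, `e_μ(t) := NormedSpace.exp (Complex.I • ((t : ℂ) • σ_μ))` written out
literally everywhere — no notation, no definition):
* §1 letters: `trace_spinHalfPauli` (`tr σ_μ = 0`), `trace_smul_pauli`, `isHermitian_smul_pauli`, `isHermitian_and_trace_smul_pauli`
  (a real multiple of `σ_μ` is Hermitian and traceless — the applicability clause of ✓`Prop7TPrint.coe_expHerm`), `pauli_eq_spinHalfPauli`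
  (print's `B10Eq18SigmaSU2.pauli` IS the quantum-lattice `spinHalfPauli`, `rfl`), `I_smul_smul_pauli_eq_su2Coord` (`i t σ_μ = su2Coord (t e_μ)`),
  `spinHalfPauli_mem_unitary` ∕ `norm_spinHalfPauli` (`‖σ_μ‖ = 1` in the `L²`-operator norm; cited, not restated:
  ✓`Z2GaugeHiggs.spinHalfPauli_mul_self` ∕ `spinHalfPauli_isHermitian`).
* §2 `sinc_abs_mul_self` (`sinc |t| · t = sin t`); ★ `exp_I_smul_pauli` — EULER'S FORMULA `e_μ(t) = cos t • 1 + (i sin t) • σ_μ` (from the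
  tree's closed form of the `SU(2)` exponential ✓`B10Eq18SigmaSU2Haar.exp_su2Coord` at `t e_μ`); `exp_I_smul_pauli_zero` (`e_μ(0) = 1`);
  `commute_I_smul_pauli`; ★ `exp_I_smul_pauli_mul` (`e_μ(a) e_μ(b) = e_μ(a + b)`, same axis: `Matrix.exp_add_of_commute`);
  `exp_I_smul_pauli_neg_mul` ∕ `exp_I_smul_pauli_mul_neg` (`e_μ(−t)` is the inverse).
* §3 `coe_expPauli_single` (print's chart point `expPauli (t e_μ)` has matrix `e_μ(t)`); ★ `norm_exp_I_smul_pauli_sub_one_le` —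
  `‖e_μ(t) − 1‖ ≤ |t|` (chord ≤ arc, via ✓`dist1_expPoint_le`), hence the form named in the work order
  `norm_exp_I_smul_pauli_sub_one_le_two_mul : ‖e_μ(t) − 1‖ ≤ 2|t|`.
* §4 the dictionary to the route's objects: `expHerm_smul_pauli_eq_expPauli` (`expHerm (t • σ_μ) = expPauli (t e_μ)` in `SU(2)`),
  `coe_expHerm_smul_pauli` ∕ `coe_expHerm_smul_pauli_eq` (matrix = `e_μ(t)` = Euler form), `expHerm_smul_pauli_zero`,
  ★ `expHerm_smul_pauli_mul` (one-parameter subgroup of `SU(2)`), `expHerm_smul_pauli_inv`, ★ `dist1_expHerm_smul_pauli_le`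
  (`dist1 (expHerm (t • σ_μ)) ≤ |t|` — the bond-smallness letter for «`U_s ∈ RegPr ρ` for small `s`», piece (N3)).

HONEST FRAMING.  Elementary matrix calculus over landed tree letters; `hPcol` is a display BINDER — NEG-hPcol is negative knowledge of
record for TARGET.md footnote 17v, NOT an item refutation, NOT a display event, NOT progress on EX; nothing of EX ∕ the 13 print rows ∕
`hThm2S` ∕ 19200 ∕ any crux or rung statement is proved here; the Yang–Mills mass gap is NOT proved.

References: [Balaban1985UV3] T. Bałaban, CMP 102 (1985) 255–275, p. 260 («the three Pauli matrices (generators of the Lie algebra)»,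
the chart `A ↦ exp iA`); [Balaban1985Variational] T. Bałaban, CMP 102 (1985) 277–309, (19) p. 281 and (112) p. 294 (`U₁ = e^{iηA}`);
[Tasaki2020] H. Tasaki, *Physics and Mathematics of Quantum Many-Body Systems*, Springer GTP (2020), §2.1 (2.1.8) (Pauli matrices).
-/

noncomputable section

open scoped Matrix.Norms.L2Operator
open NormedSpace (exp)
open Literature.MathematicalPhysics.QuantumLattice (spinHalfPauli)
open Literature.MathematicalPhysics.QuantumLattice.Z2GaugeHiggs (spinHalfPauli_mul_self spinHalfPauli_isHermitian)
open Literature.MathematicalPhysics.QuantumFieldTheory.Balaban1983to89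
open Literature.MathematicalPhysics.QuantumFieldTheory.Balaban1983to89.B10Eq18SigmaSU2 (pauli su2Coord su2Coord_eq_sum)
open Literature.MathematicalPhysics.QuantumFieldTheory.Balaban1983to89.B10Eq18SigmaSU2Haar
  (exp_su2Coord expPauli coe_expPauli expPauli_eq_expPoint norm_rev)
open Literature.MathematicalPhysics.QuantumFieldTheory.Balaban1983to89.T4ExpWindowSmallField (dist1_eq_norm_coe_sub_one dist1_expPoint_le)
open Summit.QuantumFields.YangMills.Theorems.Prop7TPrint (expHerm coe_expHerm)

namespace Summit.QuantumFields.YangMills.Theorems.Prop7HPcolNegPauliExp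

/-! ## §1 Letters: trace, Hermiticity, the dictionary to print's Pauli coordinates, the norm of `σ_μ` -/

/-- `tr σ_μ = 0`. [cite: Tasaki2020, §2.1 (2.1.8)] -/
theorem trace_spinHalfPauli (μ : Fin 3) : (spinHalfPauli μ).trace = 0 := by
  fin_cases μ <;> simp [spinHalfPauli]

/-- A complex multiple of `σ_μ` is traceless. [cite: Tasaki2020, §2.1 (2.1.8)] -/
theorem trace_smul_pauli (μ : Fin 3) (c : ℂ) : (c • spinHalfPauli μ).trace = 0 := by
  rw [Matrix.trace_smul, trace_spinHalfPauli, smul_zero]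

/-- A REAL multiple of `σ_μ` is Hermitian (print's `A = Σ A^aσ_a` with real `A^a`). [cite: Balaban1985Variational, (19) p.281] -/
theorem isHermitian_smul_pauli (μ : Fin 3) (t : ℝ) : (((t : ℝ) : ℂ) • spinHalfPauli μ).IsHermitian := by
  unfold Matrix.IsHermitian
  rw [Matrix.conjTranspose_smul, (spinHalfPauli_isHermitian μ).eq, Complex.star_def, Complex.conj_ofReal]

/-- The applicability clause of ✓`Prop7TPrint.coe_expHerm` for the bond exponent `t • σ_μ`: Hermitian AND traceless.
[cite: Balaban1985Variational, (112) p.294] -/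
theorem isHermitian_and_trace_smul_pauli (μ : Fin 3) (t : ℝ) :
    (((t : ℝ) : ℂ) • spinHalfPauli μ).IsHermitian ∧ (((t : ℝ) : ℂ) • spinHalfPauli μ).trace = 0 :=
  ⟨isHermitian_smul_pauli μ t, trace_smul_pauli μ _⟩

/-- Print's Pauli matrices `B10Eq18SigmaSU2.pauli` ARE the quantum-lattice `spinHalfPauli` (same three matrix literals). [cite: Balaban1985UV3, p. 260] -/
theorem pauli_eq_spinHalfPauli : pauli = spinHalfPauli := rfl

/-- `i t σ_μ = su2Coord (t e_μ)`: the one-axis exponent is print's Pauli coordinate of the vector `t e_μ ∈ ℝ³`. [cite: Balaban1985UV3, p. 260] -/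
theorem I_smul_smul_pauli_eq_su2Coord (μ : Fin 3) (t : ℝ) :
    Complex.I • (((t : ℝ) : ℂ) • spinHalfPauli μ) = su2Coord (EuclideanSpace.single μ t) := by
  rw [su2Coord_eq_sum, Finset.sum_eq_single μ, PiLp.single_apply, if_pos rfl, smul_smul, mul_comm, pauli_eq_spinHalfPauli]
  · intro a _ ha
    rw [PiLp.single_apply, if_neg ha, Complex.ofReal_zero, zero_mul, zero_smul]
  · intro h
    exact absurd (Finset.mem_univ μ) h

/-- `σ_μ` is unitary (`σ_μ* σ_μ = σ_μ σ_μ* = 1`: Hermitian with `σ_μ² = 1`). [cite: Tasaki2020, §2.1 (2.1.8)] -/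
theorem spinHalfPauli_mem_unitary (μ : Fin 3) : spinHalfPauli μ ∈ unitary (Matrix (Fin 2) (Fin 2) ℂ) := by
  rw [Unitary.mem_iff, Matrix.star_eq_conjTranspose, (spinHalfPauli_isHermitian μ).eq, spinHalfPauli_mul_self]
  exact ⟨rfl, rfl⟩

/-- `‖σ_μ‖ = 1` in the `L²`-operator norm. [cite: Balaban1985Averaging, (19) p.21] -/
theorem norm_spinHalfPauli (μ : Fin 3) : ‖spinHalfPauli μ‖ = 1 :=
  CStarRing.norm_of_mem_unitary (spinHalfPauli_mem_unitary μ)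

/-! ## §2 Euler's formula for `exp(i t σ_μ)`, the group law along one axis -/

/-- `sinc |t| · t = sin t`. [folklore] -/
theorem sinc_abs_mul_self (t : ℝ) : Real.sinc |t| * t = Real.sin t := by
  rcases eq_or_ne t 0 with rfl | ht
  · simp
  · rcases le_or_gt 0 t with h | h
    · rw [abs_of_nonneg h, Real.sinc_of_ne_zero ht, div_mul_cancel₀ _ ht]
    · rw [abs_of_neg h, Real.sinc_neg, Real.sinc_of_ne_zero ht, div_mul_cancel₀ _ ht]

/-- ★ **EULER'S FORMULA ALONG ONE PAULI AXIS: `exp(i t σ_μ) = cos t • 1 + (i sin t) • σ_μ`** (`σ_μ² = 1`; the tree's closed form of the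
`SU(2)` exponential ✓`exp_su2Coord` at the vector `t e_μ`, `|t e_μ| = |t|`, `cos |t| = cos t`, `sinc |t| · t = sin t`). [cite: Balaban1985UV3, p. 260] -/
theorem exp_I_smul_pauli (μ : Fin 3) (t : ℝ) :
    exp (Complex.I • (((t : ℝ) : ℂ) • spinHalfPauli μ)) =
      ((Real.cos t : ℝ) : ℂ) • (1 : Matrix (Fin 2) (Fin 2) ℂ) + (Complex.I * ((Real.sin t : ℝ) : ℂ)) • spinHalfPauli μ := by
  have hs : ((Real.sinc |t| : ℝ) : ℂ) * Complex.I * ((t : ℝ) : ℂ) = Complex.I * ((Real.sin t : ℝ) : ℂ) := by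
    rw [← sinc_abs_mul_self t, Complex.ofReal_mul]; ring
  rw [I_smul_smul_pauli_eq_su2Coord, exp_su2Coord, PiLp.norm_single, Real.norm_eq_abs, Real.cos_abs,
    ← I_smul_smul_pauli_eq_su2Coord, smul_smul, smul_smul, hs]

/-- `exp(i·0·σ_μ) = 1`. [cite: Balaban1985UV3, p. 260] -/
theorem exp_I_smul_pauli_zero (μ : Fin 3) : exp (Complex.I • (((0 : ℝ) : ℂ) • spinHalfPauli μ)) = 1 := by
  rw [Complex.ofReal_zero, zero_smul, smul_zero, NormedSpace.exp_zero]

/-- Two exponents on the SAME axis commute. [folklore] -/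
theorem commute_I_smul_pauli (μ : Fin 3) (a b : ℝ) :
    Commute (Complex.I • (((a : ℝ) : ℂ) • spinHalfPauli μ)) (Complex.I • (((b : ℝ) : ℂ) • spinHalfPauli μ)) := by
  rw [smul_smul, smul_smul]
  exact ((Commute.refl (spinHalfPauli μ)).smul_left _).smul_right _

/-- ★ **THE GROUP LAW ALONG ONE AXIS: `exp(i a σ_μ) · exp(i b σ_μ) = exp(i (a + b) σ_μ)`.** [cite: Balaban1985UV3, p. 260] -/
theorem exp_I_smul_pauli_mul (μ : Fin 3) (a b : ℝ) :
    exp (Complex.I • (((a : ℝ) : ℂ) • spinHalfPauli μ)) * exp (Complex.I • (((b : ℝ) : ℂ) • spinHalfPauli μ)) =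
      exp (Complex.I • (((a + b : ℝ) : ℂ) • spinHalfPauli μ)) := by
  rw [← Matrix.exp_add_of_commute _ _ (commute_I_smul_pauli μ a b), ← smul_add, ← add_smul, ← Complex.ofReal_add]

/-- `exp(−i t σ_μ) · exp(i t σ_μ) = 1`. [cite: Balaban1985UV3, p. 260] -/
theorem exp_I_smul_pauli_neg_mul (μ : Fin 3) (t : ℝ) :
    exp (Complex.I • (((-t : ℝ) : ℂ) • spinHalfPauli μ)) * exp (Complex.I • (((t : ℝ) : ℂ) • spinHalfPauli μ)) = 1 := by
  rw [exp_I_smul_pauli_mul, neg_add_cancel, exp_I_smul_pauli_zero]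

/-- `exp(i t σ_μ) · exp(−i t σ_μ) = 1`. [cite: Balaban1985UV3, p. 260] -/
theorem exp_I_smul_pauli_mul_neg (μ : Fin 3) (t : ℝ) :
    exp (Complex.I • (((t : ℝ) : ℂ) • spinHalfPauli μ)) * exp (Complex.I • (((-t : ℝ) : ℂ) • spinHalfPauli μ)) = 1 := by
  rw [exp_I_smul_pauli_mul, add_neg_cancel, exp_I_smul_pauli_zero]

/-! ## §3 The distance to the identity: chord ≤ arc -/

/-- The matrix of print's chart point `expPauli (t e_μ)` is `exp(i t σ_μ)`. [cite: Balaban1985UV3, p. 260] -/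
theorem coe_expPauli_single (μ : Fin 3) (t : ℝ) :
    ((expPauli (EuclideanSpace.single μ t) : Matrix.specialUnitaryGroup (Fin 2) ℂ) : Matrix (Fin 2) (Fin 2) ℂ) =
      exp (Complex.I • (((t : ℝ) : ℂ) • spinHalfPauli μ)) := by
  rw [coe_expPauli, I_smul_smul_pauli_eq_su2Coord]

/-- ★ **`‖exp(i t σ_μ) − 1‖ ≤ |t|`** (`L²`-operator norm; chord ≤ arc on `SU(2) ≅ S³`: ✓`dist1_expPoint_le` through `expPauli = expPoint ∘ rev`).
[cite: Balaban1985Averaging, (19) p.21] -/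
theorem norm_exp_I_smul_pauli_sub_one_le (μ : Fin 3) (t : ℝ) :
    ‖exp (Complex.I • (((t : ℝ) : ℂ) • spinHalfPauli μ)) - 1‖ ≤ |t| := by
  have h := dist1_expPoint_le (B10Eq18SigmaSU2Haar.rev (EuclideanSpace.single μ t))
  rw [← expPauli_eq_expPoint, dist1_eq_norm_coe_sub_one, coe_expPauli_single, norm_rev, PiLp.norm_single,
    Real.norm_eq_abs] at h
  exact h

/-- `‖exp(i t σ_μ) − 1‖ ≤ 2|t|` (the constant named in px12 g11's work order; immediate from `≤ |t|`). [cite: Balaban1985Averaging, (19) p.21] -/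
theorem norm_exp_I_smul_pauli_sub_one_le_two_mul (μ : Fin 3) (t : ℝ) :
    ‖exp (Complex.I • (((t : ℝ) : ℂ) • spinHalfPauli μ)) - 1‖ ≤ 2 * |t| :=
  (norm_exp_I_smul_pauli_sub_one_le μ t).trans (by linarith [abs_nonneg t])

/-! ## §4 The dictionary to the route's `expHerm` (the bond values of px12's family) -/

/-- The matrix of `expHerm (t • σ_μ)` is `exp(i t σ_μ)` (the Hermitian-traceless clause holds, §1). [cite: Balaban1985Variational, (112) p.294] -/
theorem coe_expHerm_smul_pauli (μ : Fin 3) (t : ℝ) :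
    ((expHerm (((t : ℝ) : ℂ) • spinHalfPauli μ) : Matrix.specialUnitaryGroup (Fin 2) ℂ) : Matrix (Fin 2) (Fin 2) ℂ) =
      exp (Complex.I • (((t : ℝ) : ℂ) • spinHalfPauli μ)) :=
  coe_expHerm (isHermitian_and_trace_smul_pauli μ t)

/-- ★ The matrix of `expHerm (t • σ_μ)` in EULER FORM: `cos t • 1 + (i sin t) • σ_μ`. [cite: Balaban1985Variational, (112) p.294] -/
theorem coe_expHerm_smul_pauli_eq (μ : Fin 3) (t : ℝ) :
    ((expHerm (((t : ℝ) : ℂ) • spinHalfPauli μ) : Matrix.specialUnitaryGroup (Fin 2) ℂ) : Matrix (Fin 2) (Fin 2) ℂ) =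
      ((Real.cos t : ℝ) : ℂ) • (1 : Matrix (Fin 2) (Fin 2) ℂ) + (Complex.I * ((Real.sin t : ℝ) : ℂ)) • spinHalfPauli μ := by
  rw [coe_expHerm_smul_pauli, exp_I_smul_pauli]

/-- **`expHerm (t • σ_μ) = expPauli (t e_μ)`** as elements of `SU(2)`: the route's log-coordinate bond map at a one-axis exponent IS print's chart
point (so the whole `expPauli`∕`expPoint` API — continuity, measurability, injectivity on `|·| < π`, `dist1` formulas — applies).
[cite: Balaban1985UV3, p. 260; Balaban1985Variational, (112) p.294] -/
theorem expHerm_smul_pauli_eq_expPauli (μ : Fin 3) (t : ℝ) :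
    expHerm (((t : ℝ) : ℂ) • spinHalfPauli μ) = expPauli (EuclideanSpace.single μ t) :=
  Subtype.ext (by rw [coe_expHerm_smul_pauli, coe_expPauli_single])

/-- `expHerm (0 • σ_μ) = 1`. [cite: Balaban1985Variational, (112) p.294] -/
theorem expHerm_smul_pauli_zero (μ : Fin 3) : expHerm (((0 : ℝ) : ℂ) • spinHalfPauli μ) = 1 :=
  Subtype.ext (by rw [coe_expHerm_smul_pauli, exp_I_smul_pauli_zero]; rfl)

/-- ★ **ONE-PARAMETER SUBGROUP OF `SU(2)`: `expHerm (a • σ_μ) · expHerm (b • σ_μ) = expHerm ((a + b) • σ_μ)`.** [cite: Balaban1985Variational, (112) p.294] -/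
theorem expHerm_smul_pauli_mul (μ : Fin 3) (a b : ℝ) :
    expHerm (((a : ℝ) : ℂ) • spinHalfPauli μ) * expHerm (((b : ℝ) : ℂ) • spinHalfPauli μ) =
      expHerm (((a + b : ℝ) : ℂ) • spinHalfPauli μ) :=
  Subtype.ext (by
    rw [Submonoid.coe_mul, coe_expHerm_smul_pauli, coe_expHerm_smul_pauli, coe_expHerm_smul_pauli,
      exp_I_smul_pauli_mul])

/-- The inverse along the axis: `(expHerm (t • σ_μ))⁻¹ = expHerm ((−t) • σ_μ)`. [cite: Balaban1985Variational, (112) p.294] -/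
theorem expHerm_smul_pauli_inv (μ : Fin 3) (t : ℝ) :
    (expHerm (((t : ℝ) : ℂ) • spinHalfPauli μ))⁻¹ = expHerm (((-t : ℝ) : ℂ) • spinHalfPauli μ) := by
  rw [inv_eq_iff_mul_eq_one, expHerm_smul_pauli_mul, add_neg_cancel, expHerm_smul_pauli_zero]

/-- ★ **BOND SMALLNESS: `dist1 (expHerm (t • σ_μ)) ≤ |t|`** — the letter behind «`U_s ∈ RegPr ρ` for small `s`» (piece (N3)).
[cite: Balaban1985Averaging, (19) p.21; Balaban1985Variational, (19) p.281] -/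
theorem dist1_expHerm_smul_pauli_le (μ : Fin 3) (t : ℝ) :
    GaugeGroup.dist1 (expHerm (((t : ℝ) : ℂ) • spinHalfPauli μ)) ≤ |t| := by
  rw [dist1_eq_norm_coe_sub_one, coe_expHerm_smul_pauli]
  exact norm_exp_I_smul_pauli_sub_one_le μ t

end Summit.QuantumFields.YangMills.Theorems.Prop7HPcolNegPauliExp

end
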